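import Mathlib
import Literature.MathematicalPhysics.QuantumFieldTheory.Balaban1983to89.B14RelBoundary

/-!
# `Balaban1983to89.B16Eq1101Subtraction` — the U = 1 subtraction missing from (1.101) of T. Bałaban, *Large field
renormalization. II*, Commun. Math. Phys. **122**, 355–392 (1989), doi:10.1007/bf01238433 [Balaban1989LargeFieldII],
p. 390 [PDF 36], against the inductive clause (2.30) of *Convergent renormalization expansions for lattice gauge
theories*, Commun. Math. Phys. **119**, 243–285 (1988), doi:10.1007/bf01217741 [Balaban1988Convergent], p. 260 [PDF 18].

CITATION HEADER (lean-in-tree rule 2026-08-18).  Reproduced: the bookkeeping behind ONE unprinted clause of a published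
paper under adjudication by the audit cell `pub-balaban` (cell paper B16; GAPS row G-adv3-8 (A), adversarial reader 3,
gen 5–6).  Printed, p. 390 verbatim: *"A_k = A′_k + Σ_X 𝐑′^{(k)}(X,U_k) + Σ_X 𝐁′^{(k)}(X,U_k). (1.101) This new action
satisfies the induction hypothesis, as it follows from the construction and the properties of the new terms."*  The
hypothesis it must satisfy, [III] p. 260 verbatim: *"𝐑_k(U_k) = Σ_{j=1}^{k} [𝐑^{(j)}(Λ_j,U_k) − 𝐑^{(j)}(Λ_j,1)] (2.30)"*.
(1.101) carries the k-th 𝐑-sum UNSUBTRACTED; no sentence of B16 mentions the constant Σ_X 𝐑′^{(k)}(X,1).  Nothing of the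
series is asserted; the manuscript is not cited for the disputed step.

WHAT IS CHECKED (finite sums only; every analytic input a NAMED HYPOTHESIS):
* `subtracted_form` — (1.101) rewritten in the (2.30) shape: `Σ_X 𝐑′(X,φ) = Σ_X [𝐑′(X,φ) − 𝐑′(X,1)] + c` with the
  U-independent constant `c = Σ_X 𝐑′^{(k)}(X,1)` (pure algebra);
* `subtracted_term_bound` — the subtracted terms obey TWICE the (1.100) bound, `‖𝐑′(X,φ) − 𝐑′(X,1)‖ ≤ 2e^{−p₀(g_k)}e^{−κd_k(X)}`,
  PROVIDED the trivial configuration `(1,0)` lies in the analyticity domain `Ũ^c_k(X,α̃₀,α̃₁)` (hypothesis `hone`; true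
  for the printed definition [III] (2.34)–(2.39) p. 261, where every bound is a strict inequality satisfied with 0 on the
  left — reader-level, not typed here);
* `constant_bound` — the constant is charged to the vacuum-energy counterterm E_k within its p. 264 budget
  `O(1)Σ_n|Γ_n|`: with ANCHORING DATA (every second-group domain X contains a first-class component, p. 378 / (1.98);
  `anchor`, `above`) and the anchored tree-graph summability `Σ_{X ∈ above c} e^{−κd_k(X)} ≤ K` (the same leaf as
  `B14.RelBoundary.RelAnchoredBound`, hypothesis H4 of cell GAPS C-b01-J1 — never asserted), `‖c‖ ≤ e^{−p₀(g_k)}·K·#components`,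
  and `constant_le_volume` turns `#components ≤ Σ_n|Γ_n|` (each component of Z_k ⊂ B = ∪Γ_j contains a cube of the
  determining set, [III] (2.1)–(2.3) p. 255; a hypothesis `hcard`) into the p. 264 shape;
* `eq1101_in_form230` — the three assembled: `∃ c, (∀ φ, Σ_X 𝐑′(X,φ) = Σ_X[𝐑′(X,φ) − 𝐑′(X,1)] + c) ∧ ‖c‖ ≤ e^{−p₀(g_k)} K vol`.
The mechanism is reused from `B14.RelBoundary.ringBound` (unit b01-g2); what is NEW is only the instantiation at the
constant `Σ_X 𝐑′^{(k)}(X,1)` — which is exactly the clause B16 does not print.  Load-bearing for the p. 260 "marginal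
term" mechanism at later scales (GAPS G-adv3-8 (A)), not for (1.99)/(1.100) themselves.
-/

namespace Literature.MathematicalPhysics.QuantumFieldTheory.Balaban1983to89.B16.Eq1101

open Literature.MathematicalPhysics.QuantumFieldTheory.Balaban1983to89
open Finset

/-- (1.101) in the (2.30) shape: pure algebra, `Σ a = Σ (a − b) + Σ b`. [cite: Balaban1989LargeFieldII, (1.101) p.390;
Balaban1988Convergent, (2.30) p.260] -/
theorem subtracted_form {ι Φ : Type*} (G : Finset ι) (R' : ι → Φ → ℂ) (one φ : Φ) :
    ∑ X ∈ G, R' X φ = ∑ X ∈ G, (R' X φ - R' X one) + ∑ X ∈ G, R' X one := by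
  rw [← Finset.sum_add_distrib]
  refine Finset.sum_congr rfl fun X _ => ?_
  ring

/-- The subtracted term obeys twice the (1.100) bound, given that the trivial configuration `one = (1,0)` lies in the
analyticity domain of every second-group domain (`hone`). [cite: Balaban1989LargeFieldII, (1.100) p.390] -/
theorem subtracted_term_bound (S : RelDomainSys) {Φ : Type*} (dom : S.Dom → Set Φ) (R' : S.Dom → Φ → ℂ)
    (p0val κ : ℝ) (h1100 : Ineq1100 S dom R' p0val κ) (one : Φ)
    (X : S.Dom) (hX : ¬ S.MeetsLF X) (hone : one ∈ dom X) (φ : Φ) (hφ : φ ∈ dom X) :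
    ‖R' X φ - R' X one‖ ≤ 2 * (Real.exp (-p0val) * Real.exp (-κ * S.dj X)) := by
  have h1 := h1100 X hX φ hφ
  have h2 := h1100 X hX one hone
  calc ‖R' X φ - R' X one‖ ≤ ‖R' X φ‖ + ‖R' X one‖ := norm_sub_le _ _
    _ ≤ _ := by linarith

/-- THE CONSTANT `c = Σ_{X ∈ G} 𝐑′^{(k)}(X,1)` IS CHARGED TO E_k: with anchoring data (`anchor X ∈ comps` = a first-class
component contained in X, fibres `above c`, both hypotheses) and the anchored tree-graph summability `hK` (the leaf of
`B14.RelBoundary.RelAnchoredBound`, never asserted), `‖c‖ ≤ e^{−p₀(g_k)}·K·#comps`.  Instance of `B14.RelBoundary.ringBound`.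
[cite: Balaban1989LargeFieldII, (1.100) p.390, p.378 ll.24–35; Balaban1988Convergent, p.264 (E_k budget)] -/
theorem constant_bound (S : RelDomainSys) {Φ : Type*} (dom : S.Dom → Set Φ) (R' : S.Dom → Φ → ℂ)
    (p0val κ : ℝ) (h1100 : Ineq1100 S dom R' p0val κ) (one : Φ)
    (G : Finset S.Dom) (hG : ∀ X ∈ G, ¬ S.MeetsLF X) (hone : ∀ X ∈ G, one ∈ dom X)
    {C : Type*} [DecidableEq C] (comps : Finset C) (above : C → Finset S.Dom) (anchor : S.Dom → C)
    (hmem : ∀ X ∈ G, anchor X ∈ comps) (habove : ∀ X ∈ G, X ∈ above (anchor X))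
    (K : ℝ) (hK : ∀ c ∈ comps, ∑ X ∈ above c, Real.exp (-κ * S.dj X) ≤ K) :
    ‖∑ X ∈ G, R' X one‖ ≤ Real.exp (-p0val) * K * comps.card :=
  B14.RelBoundary.ringBound G comps above anchor (fun X => R' X one) (fun X => Real.exp (-κ * S.dj X))
    (Real.exp (-p0val)) K (Real.exp_pos _).le (fun _ => (Real.exp_pos _).le)
    (fun X hX => h1100 X (hG X hX) one (hone X hX)) hmem habove hK

/-- The p. 264 shape: `#comps ≤ vol` (= `Σ_n |Γ_n|` in cube units, a hypothesis: every component of `Z_k = Λ_k^c` lies in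
the determining set `B = ∪_j Γ_j`, [III] (2.1)–(2.3)) gives `‖c‖ ≤ e^{−p₀(g_k)} K vol`. [cite: Balaban1988Convergent, p.264] -/
theorem constant_le_volume (p0val K vol : ℝ) (hK : 0 ≤ K) (n : ℕ) (hcard : (n : ℝ) ≤ vol)
    (c : ℂ) (hc : ‖c‖ ≤ Real.exp (-p0val) * K * n) :
    ‖c‖ ≤ Real.exp (-p0val) * K * vol :=
  hc.trans (mul_le_mul_of_nonneg_left hcard (mul_nonneg (Real.exp_pos _).le hK))

/-- ASSEMBLY: under the hypotheses above, (1.101) satisfies the (2.30) clause up to a U-independent constant within the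
E_k budget: `∃ c, (∀ φ, Σ_X 𝐑′(X,φ) = Σ_X [𝐑′(X,φ) − 𝐑′(X,1)] + c) ∧ ‖c‖ ≤ e^{−p₀(g_k)} K vol`, and every subtracted term
obeys `2e^{−p₀(g_k)}e^{−κ d_k(X)}` on its analyticity domain.  This is the unprinted repair of GAPS G-adv3-8 (A), with its
inputs named: `hone` ((1,0) in the domains), `hmem`/`habove` (anchoring in first-class components), `hK` (anchored
tree-graph bound), `hcard` (components counted by the determining set). [cite: Balaban1989LargeFieldII, (1.101) p.390] -/
theorem eq1101_in_form230 (S : RelDomainSys) {Φ : Type*} (dom : S.Dom → Set Φ) (R' : S.Dom → Φ → ℂ)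
    (p0val κ : ℝ) (h1100 : Ineq1100 S dom R' p0val κ) (one : Φ)
    (G : Finset S.Dom) (hG : ∀ X ∈ G, ¬ S.MeetsLF X) (hone : ∀ X ∈ G, one ∈ dom X)
    {C : Type*} [DecidableEq C] (comps : Finset C) (above : C → Finset S.Dom) (anchor : S.Dom → C)
    (hmem : ∀ X ∈ G, anchor X ∈ comps) (habove : ∀ X ∈ G, X ∈ above (anchor X))
    (K : ℝ) (hK0 : 0 ≤ K) (hK : ∀ c ∈ comps, ∑ X ∈ above c, Real.exp (-κ * S.dj X) ≤ K)
    (vol : ℝ) (hcard : (comps.card : ℝ) ≤ vol) :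
    ∃ c : ℂ, (∀ φ : Φ, ∑ X ∈ G, R' X φ = ∑ X ∈ G, (R' X φ - R' X one) + c) ∧
      ‖c‖ ≤ Real.exp (-p0val) * K * vol ∧
      ∀ X ∈ G, ∀ φ ∈ dom X, ‖R' X φ - R' X one‖ ≤ 2 * (Real.exp (-p0val) * Real.exp (-κ * S.dj X)) := by
  refine ⟨∑ X ∈ G, R' X one, fun φ => subtracted_form G R' one φ, ?_, ?_⟩
  · exact constant_le_volume p0val K vol hK0 comps.card hcard _
      (constant_bound S dom R' p0val κ h1100 one G hG hone comps above anchor hmem habove K hK)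
  · intro X hX φ hφ
    exact subtracted_term_bound S dom R' p0val κ h1100 one X (hG X hX) (hone X hX) φ hφ

end Literature.MathematicalPhysics.QuantumFieldTheory.Balaban1983to89.B16.Eq1101
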